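import Mathlib
import HarnessLib
import Literature.AlgebraicGeometry.Ramification.InertiaNormalSylow
import Literature.AlgebraicGeometry.Resolution.ResolutionOfSingularities
import Summits.ResolutionOfSingularities.ResolutionOfSingularities.Theorems.WildQuotientsWildQuotientResolutionOrbitSeparationPhaseZero
import Summits.ResolutionOfSingularities.ResolutionOfSingularities.Theorems.WildQuotientsWildQuotientResolutionKernelCorePhaseZero

/-!
# Phase 0 ⟸ separation of CLEAN tame families only: cores + separated families under Condition (K)
# (crux `WildQuotients.WildQuotientResolution`, stub `stub_phaseZeroHighDim`; any dimension)

Crux stmt-ResolutionOfSingularities-15640 (`WildQuotientResolution`), registered stub `stub_phaseZeroHighDim`.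
✓`phaseZero_of_orbitSeparation` (p822889) and ✓`phaseZero_of_primeOrbitSeparation` (p822966) reduce the stub to an
equivariant regular model SEPARATING the inert loci of the members of tame families which must cover EVERY tame
element of every non-p-closed subgroup. That target is unreachable in general: for `S₄` in characteristic `3` the
transpositions must be covered, but `⟨(12)⟩` and `⟨(34)⟩` are distinct, conjugate and COMMUTE, and the fixed points of
the tame abelian `⟨(12),(34)⟩` persist on every equivariant blow-up (eigenlines in the normal space); likewise the
base factors of `C_ℓ ≀ C_2` in characteristic `2`. With the joint kernel (✓p823531) only the tame elements of a normal
`U ⊴ I_x` with `I_x/U ↪ (κˣ)^r` matter, and those lie in `[I_x, I_x]·⟨p-elements⟩`: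

**Theorem** (`phaseZero_of_orbitSeparation_kernel`). Crux datum; `X″ → X′` an equivariant proper birational regular
model (faithful lifted action, `G`-stable affine cover) on which the conjugation-stable families `Ss` of non-trivial
tame subgroups have pairwise disjoint inert loci; `Ms` a list of non-trivial normal subgroups of order prime to `p`.
If Condition (K) holds for the list `Ms ++ members(Ss)` — every `H ≤ G` with a normal `U ≤ H`, `H/U` abelian and
`p`-torsion-free, and no `u ∈ U` of order prime to `p` lying over a core or a family member, is p-closed — then the
conclusion of `stub_phaseZeroHighDim` holds for `X′`. Engine: ✓`standardise_tameFamilies` on `X″`, then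
✓`standardise_tameCores` (the family members ride along as `done`), then ✓`exists_jointKernel_inertia`.

**Corollary** (`phaseZero_of_orbitSeparation_commutator`): it suffices that every non-p-closed `H` have a core or
a family member below some `u ∈ [H, H]` of order prime to `p`; no transposition of `S₄` ever needs separating.
CAVEAT (erratum to the first revision of this docstring): a family whose members GENERATE a tame group with a fixed
point — e.g. the three involution subgroups `{Z₁, Z₂, Z₃}` of `V₄ ≤ S₄` in characteristic `3` — can NOT be separated
on any model either (`Z_{Z₁} ∩ Z_{Z₂} = Z_{V₄}` persists), so `S₄`/`A₄` in characteristic `3` are NOT reduced to a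
reachable separation by this file; separable families are those whose distinct members pairwise generate groups WITHOUT
fixed points on the model (e.g. wild, fixed-point-free after earlier moves). What `S₄` in characteristic `3` needs is
the INERTIA DROP at the single move along `Z_{V₄}` (over `Z_{V₄}` the new inertia stabilises a character of `V₄`,
hence lies in a `D₄`), which the boundary bookkeeping of these engines does not record — see the hand-6 g4 report.

[OURS · crux stmt-ResolutionOfSingularities-15640 · helper toward `stub_phaseZeroHighDim` (reduction of the stub to
clean orbit separation + Condition (K); NOT a proof of the stub); counted 0; AI-level work, weaker than expert
review.] [folklore]
-/

-- single-problem summit: the doubled namespace component `ResolutionOfSingularities` is forced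
set_option linter.dupNamespace false

noncomputable section

open CategoryTheory AlgebraicGeometry TopologicalSpace IsLocalRing
open Literature.AlgebraicGeometry.Resolution Literature.AlgebraicGeometry.Ramification
open Scheme.IdealSheafData
open Summit.ResolutionOfSingularities.ResolutionOfSingularities.Theorems.WildQuotientResolution
open Summit.ResolutionOfSingularities.ResolutionOfSingularities.Theorems.WildQuotientResolution.PointBlowupStalkData
open Summit.ResolutionOfSingularities.ResolutionOfSingularities.Theorems.WildQuotientResolution.InertLocusStalk

namespace Summit.ResolutionOfSingularities.ResolutionOfSingularities.Theorems.WildQuotientResolution.StandardForm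

/-- **Cores + separated families under Condition (K), iterable form**: for a model `X` with an invariant separated
locally-of-finite-type structure map to `Spec k`, a faithful action, a `G`-stable affine cover, conjugation-stable
families `Ss` of non-trivial tame subgroups with pairwise disjoint inert loci on `X`, and normal non-trivial tame
cores `Ms`: if Condition (K) holds for `Ms ++ members(Ss)`, some equivariant proper birational regular model of `X`
has every inertia group p-closed (and a `G`-stable affine cover). [folklore] -/
theorem phaseZero_of_coresAndFamilies_kernel' (p : ℕ) (hp : p.Prime) (k : Type) [Field k] [CharP k p]
    (X : Scheme.{0}) (s : X ⟶ Spec (.of k)) [IsSeparated s] [LocallyOfFiniteType s] [IsIntegral X]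
    (G : Type) [Group G] [Finite G] (ρ : G →* Aut X) (hfaith : Function.Injective ρ)
    (hreg : Scheme.IsRegular X) (hρ : ∀ g : G, (ρ g).hom ≫ s = s)
    (hcov : ∀ y : X, ∃ O : X.Opens, IsAffineOpen O ∧ y ∈ O ∧ ∀ g : G, (ρ g).hom ⁻¹ᵁ O = O)
    (Ss : List (Finset (Subgroup G)))
    (hSs : ∀ S ∈ Ss, (∀ (g : G), ∀ K ∈ S, K.map (MulAut.conj g).toMonoidHom ∈ S) ∧ ⊥ ∉ S ∧
      ∀ K ∈ S, (Nat.card K).Coprime p)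
    (hdisj : ∀ S ∈ Ss, ∀ K ∈ S, ∀ K' ∈ S, K ≠ K' →
      Disjoint {y : X | K ≤ inertiaSubgroup ρ y} {y : X | K' ≤ inertiaSubgroup ρ y})
    (Ms : List (Subgroup G)) (hMs : ∀ M ∈ Ms, M.Normal ∧ M ≠ ⊥ ∧ (Nat.card M).Coprime p)
    (hcore : ∀ H U : Subgroup G, U ≤ H → (∀ h ∈ H, ∀ u ∈ U, h * u * h⁻¹ ∈ U) →
      (∀ a ∈ H, ∀ b ∈ H, a * b * a⁻¹ * b⁻¹ ∈ U) → (∀ g ∈ H, g ^ p ∈ U → g ∈ U) →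
      (∀ u ∈ U, (orderOf u).Coprime p → ∀ K ∈ Ms ++ (Ss.map Finset.toList).flatten,
        ¬ K ≤ Subgroup.zpowers u) → HasNormalSylow p H) :
    ∃ (Xs : Scheme.{0}) (π : Xs ⟶ X) (ρs : G →* Aut Xs), IsProper π ∧ IsBirational π ∧
      IsIntegral Xs ∧ Scheme.IsRegular Xs ∧ (∀ g : G, (ρs g).hom ≫ π = π ≫ (ρ g).hom) ∧
      (∀ x : Xs, HasNormalSylow p (inertiaSubgroup ρs x)) ∧
      ∀ x : Xs, ∃ U : Xs.Opens, IsAffineOpen U ∧ x ∈ U ∧ ∀ g : G, (ρs g).hom ⁻¹ᵁ U = U := by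
  classical
  haveI : Fact p.Prime := ⟨hp⟩
  haveI : IsLocallyNoetherian X := LocallyOfFiniteType.isLocallyNoetherian s
  -- step 1: the orbit moves along the separated families
  obtain ⟨X₁, π₁, ρ₁, Es₁, hπ₁p, hbir₁, hX₁, hX₁reg, hequiv₁, hcov₁, hEs₁, hEs₁inv, hest₁⟩ :=
    standardise_tameFamilies p k Ss hSs X s ρ hfaith hreg hρ hcov hdisj [] (hasSNC_nil_of_isRegular hreg)
      (fun D hD => absurd hD (by simp)) [] (fun M hM => absurd hM (by simp))
  haveI := hπ₁p; haveI := hX₁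
  have hρ₁ : ∀ g : G, (ρ₁ g).hom ≫ (π₁ ≫ s) = π₁ ≫ s := fun g => by
    rw [← Category.assoc, hequiv₁ g, Category.assoc, hρ g]
  have hfaith₁ : Function.Injective ρ₁ := injective_of_equivariant_isBirational s ρ hfaith hρ π₁ hbir₁ ρ₁ hequiv₁
  haveI : IsLocallyNoetherian X₁ := LocallyOfFiniteType.isLocallyNoetherian (π₁ ≫ s)
  -- step 2: the tame moves along the cores, the family members riding along as `done`
  obtain ⟨Xs, π₂, ρs, Es, hπ₂p, hbir₂, hXs, hXsreg, hequiv₂, hcov₂, hEs, hEsinv, hest⟩ :=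
    standardise_tameCores p k Ms hMs X₁ (π₁ ≫ s) ρ₁ hfaith₁ hX₁reg hρ₁ hcov₁ Es₁ hEs₁ hEs₁inv
      ((Ss.map Finset.toList).flatten) (fun M hM => hest₁ M (by simpa using hM))
  haveI := hπ₂p; haveI := hXs
  set π : Xs ⟶ X := π₂ ≫ π₁ with hπdef
  have hequiv : ∀ g : G, (ρs g).hom ≫ π = π ≫ (ρ g).hom := fun g => by
    rw [hπdef, ← Category.assoc, hequiv₂ g, Category.assoc, hequiv₁ g, Category.assoc]
  have hρs : ∀ g : G, (ρs g).hom ≫ (π ≫ s) = π ≫ s := fun g => by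
    rw [← Category.assoc, hequiv g, Category.assoc, hρ g]
  have hcharS : ∀ x : Xs, CharP (ResidueField (Xs.presheaf.stalk x)) p := fun x =>
    (((IsLocalRing.residue (Xs.presheaf.stalk x)).comp ((Xs.presheaf.germ ⊤ x trivial).hom.comp
      (((π ≫ s).appTop).hom.comp (Scheme.ΓSpecIso (.of k)).inv.hom))).charP_iff_charP p).mp inferInstance
  have hZ' : ∀ K : Subgroup G, IsClosed {x : Xs | K ≤ inertiaSubgroup ρs x} := fun K =>
    PointMoveNoNpcCurves.isClosed_setOf_le_inertia (π ≫ s) ρs hρs K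
  have hEstab : ∀ D ∈ Es, ∀ g : G, (ρs g).hom.base ⁻¹' (D.support : Set Xs) = D.support :=
    fun D hD g => preimage_support_of_comap_eq ρs g (hEsinv D hD g)
  refine ⟨Xs, π, ρs, inferInstance, ComponentGluing.IsBirational.comp hbir₂ hbir₁, hXs, hXsreg, hequiv,
    fun x => ?_, hcov₂⟩
  haveI := hcharS x
  haveI := hXsreg x
  -- boundary members through `x`
  let T := {D' : Xs.IdealSheafData // D' ∈ Es ∧ x ∈ D'.support}
  haveI hTfin : Finite T :=
    (((List.finite_toSet Es).subset (fun D' (h : D' ∈ Es ∧ x ∈ D'.support) => h.1)).to_subtype :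
      Finite {D' : Xs.IdealSheafData | D' ∈ Es ∧ x ∈ D'.support})
  haveI : Fintype T := Fintype.ofFinite T
  let n := Fintype.card T
  let e : T ≃ Fin n := Fintype.equivFin T
  obtain ⟨hregx, u, hu, ⟨ι, hιinj, hι⟩, -⟩ := hEs x
  have hrsop : IsRsopPart (u ∘ id) := isRsopPart_comp_of_rsop rfl u hu id Function.injective_id
  let z : Fin n → Xs.presheaf.stalk x := fun i => u (ι (e.symm i))
  have hzT : ∀ D' : T, z (e D') = u (ι D') := fun D' => by simp only [z, Equiv.symm_apply_apply]
  have hvs : ∀ D' : T, stalkIdeal (vanishingIdeal D'.1.support) x = Ideal.span {u (ι D')} := fun D' => by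
    rw [hEs.vanishingIdeal_support D'.2.1, hι D']
  -- the stalk action of `I_x` and the stable lines
  obtain ⟨a, τ, hkey, hτ⟩ := exists_stalkAction ρs x (inertiaSubgroup ρs x)
    (fun g hg => apply_eq_of_mem_inertiaSubgroup ρs hg)
  have hz : ∀ i, z i ∈ maximalIdeal (Xs.presheaf.stalk x) := fun i => hu ▸ Ideal.subset_span ⟨_, rfl⟩
  have hz2 : ∀ i, z i ∉ maximalIdeal (Xs.presheaf.stalk x) ^ 2 := fun i => hrsop.not_mem_sq _
  have hstab : ∀ (g : inertiaSubgroup ρs x) (i : Fin n),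
      τ g (z i) ∈ Ideal.span {z i} ⊔ maximalIdeal (Xs.presheaf.stalk x) ^ 2 := fun g i =>
    apply_mem_span_of_stalkIdeal_eq_span ρs x a τ hkey hτ (e.symm i).1.support
      (fun g => hEstab _ (e.symm i).2.1 (g : G)) (hvs (e.symm i)) g
  -- the joint kernel, and Condition (K)
  obtain ⟨U, hUle, hUn, hcomm, hroot, hU⟩ := exists_jointKernel_inertia ρs p x a τ hkey hτ z hz hz2 hstab
  refine hcore _ U hUle hUn hcomm hroot fun w hw hcop K hK hKw => ?_
  let g : inertiaSubgroup ρs x := ⟨w, hUle hw⟩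
  have hg : (orderOf g).Coprime p := by rwa [Subgroup.orderOf_mk]
  have hKmem : K ∈ (Ss.map Finset.toList).flatten ++ Ms := by
    rw [List.mem_append] at hK ⊢
    exact hK.symm
  have hsub : {y : Xs | Subgroup.zpowers (g : G) ≤ inertiaSubgroup ρs y} ⊆ ⋃ D ∈ Es, (D.support : Set Xs) :=
    hest K hKmem (g : G) hcop hKw
  obtain ⟨D, hD, hxD, hle⟩ :=
    exists_mem_stalkIdeal_le_augIdeal_of_subset_iUnion ρs p x a τ hkey hτ g hg g.2 (hZ' _) Es hsub
  refine hU g hw hcop (e ⟨D, hD, hxD⟩) ?_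
  rw [hzT]
  exact Ideal.mem_sup_left (hle ((hvs ⟨D, hD, hxD⟩) ▸ Ideal.mem_span_singleton_self _))

/-- **Phase 0 ⟸ clean orbit separation + Condition (K)** (crux stmt-ResolutionOfSingularities-15640; reduction of
`stub_phaseZeroHighDim`). Crux data (`k` of characteristic `p`, `X₁/k` separated of finite type, `X′` integral, `q`
finite, `ρ` an action over `q`); an equivariant proper birational regular model `π₀ : X″ → X′` with faithful lifted
action and a `G`-stable affine cover, on which the conjugation-stable families `Ss` of non-trivial tame subgroups have
pairwise disjoint inert loci; normal non-trivial tame cores `Ms`; Condition (K) for `Ms ++ members(Ss)`. Then the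
conclusion of `stub_phaseZeroHighDim` holds for `X′`, in every dimension. (p822889 = the case where the families
and cores cover every tame element of every non-p-closed subgroup.) [folklore] -/
theorem phaseZero_of_orbitSeparation_kernel (p : ℕ) (hp : p.Prime) (k : Type) [Field k] [CharP k p]
    (X' X₁ : Scheme.{0}) (f : X₁ ⟶ Spec (.of k)) (q : X' ⟶ X₁) (G : Type) [Group G] [Finite G]
    (ρ : G →* Aut X')
    [IsSeparated f] [LocallyOfFiniteType f] [QuasiCompact f] [IsIntegral X'] [IsFinite q]
    (hρ : ∀ g : G, (ρ g).hom ≫ q = q)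
    (X'' : Scheme.{0}) (π₀ : X'' ⟶ X') (ρ'' : G →* Aut X'') [IsProper π₀] (hbir₀ : IsBirational π₀)
    [IsIntegral X''] (hreg'' : Scheme.IsRegular X'') (hfaith'' : Function.Injective ρ'')
    (hequiv₀ : ∀ g : G, (ρ'' g).hom ≫ π₀ = π₀ ≫ (ρ g).hom)
    (hcov'' : ∀ y : X'', ∃ O : X''.Opens, IsAffineOpen O ∧ y ∈ O ∧ ∀ g : G, (ρ'' g).hom ⁻¹ᵁ O = O)
    (Ss : List (Finset (Subgroup G)))
    (hSs : ∀ S ∈ Ss, (∀ (g : G), ∀ K ∈ S, K.map (MulAut.conj g).toMonoidHom ∈ S) ∧ ⊥ ∉ S ∧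
      ∀ K ∈ S, (Nat.card K).Coprime p)
    (hdisj : ∀ S ∈ Ss, ∀ K ∈ S, ∀ K' ∈ S, K ≠ K' →
      Disjoint {y : X'' | K ≤ inertiaSubgroup ρ'' y} {y : X'' | K' ≤ inertiaSubgroup ρ'' y})
    (Ms : List (Subgroup G)) (hMs : ∀ M ∈ Ms, M.Normal ∧ M ≠ ⊥ ∧ (Nat.card M).Coprime p)
    (hcore : ∀ H U : Subgroup G, U ≤ H → (∀ h ∈ H, ∀ u ∈ U, h * u * h⁻¹ ∈ U) →
      (∀ a ∈ H, ∀ b ∈ H, a * b * a⁻¹ * b⁻¹ ∈ U) → (∀ g ∈ H, g ^ p ∈ U → g ∈ U) →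
      (∀ u ∈ U, (orderOf u).Coprime p → ∀ K ∈ Ms ++ (Ss.map Finset.toList).flatten,
        ¬ K ≤ Subgroup.zpowers u) → HasNormalSylow p H) :
    ∃ (Xs : Scheme.{0}) (π : Xs ⟶ X') (ρs : G →* Aut Xs), IsProper π ∧ IsBirational π ∧
      IsIntegral Xs ∧ Scheme.IsRegular Xs ∧ (∀ g : G, (ρs g).hom ≫ π = π ≫ (ρ g).hom) ∧
      (∀ x : Xs, HasNormalSylow p (inertiaSubgroup ρs x)) ∧
      ∀ x : Xs, ∃ U : Xs.Opens, IsAffineOpen U ∧ x ∈ U ∧ ∀ g : G, (ρs g).hom ⁻¹ᵁ U = U := by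
  have hρ'' : ∀ g : G, (ρ'' g).hom ≫ (π₀ ≫ q ≫ f) = π₀ ≫ q ≫ f := fun g => by
    rw [← Category.assoc, hequiv₀ g, Category.assoc, ← Category.assoc (ρ g).hom, hρ g]
  obtain ⟨Xs, π, ρs, hπp, hbir, hXs, hXsreg, hequiv, hNpS, hcov⟩ :=
    phaseZero_of_coresAndFamilies_kernel' p hp k X'' (π₀ ≫ q ≫ f) G ρ'' hfaith'' hreg'' hρ'' hcov'' Ss hSs hdisj
      Ms hMs hcore
  haveI := hπp
  refine ⟨Xs, π ≫ π₀, ρs, inferInstance, ComponentGluing.IsBirational.comp hbir hbir₀, hXs, hXsreg, fun g => ?_,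
    hNpS, hcov⟩
  rw [← Category.assoc, hequiv g, Category.assoc, hequiv₀ g, Category.assoc]

/-- **Commutator form** (crux stmt-ResolutionOfSingularities-15640). Same model data; if every non-p-closed `H ≤ G`
has a core or a family member below some `u ∈ [H, H]` of order prime to `p`, the conclusion of
`stub_phaseZeroHighDim` holds for `X′`. (Families of pairwise-commuting members with a common fixed point are never
separable — see the CAVEAT in the module docstring; this is a reduction, not a new unconditional class.) [folklore] -/
theorem phaseZero_of_orbitSeparation_commutator (p : ℕ) (hp : p.Prime) (k : Type) [Field k] [CharP k p]
    (X' X₁ : Scheme.{0}) (f : X₁ ⟶ Spec (.of k)) (q : X' ⟶ X₁) (G : Type) [Group G] [Finite G]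
    (ρ : G →* Aut X')
    [IsSeparated f] [LocallyOfFiniteType f] [QuasiCompact f] [IsIntegral X'] [IsFinite q]
    (hρ : ∀ g : G, (ρ g).hom ≫ q = q)
    (X'' : Scheme.{0}) (π₀ : X'' ⟶ X') (ρ'' : G →* Aut X'') [IsProper π₀] (hbir₀ : IsBirational π₀)
    [IsIntegral X''] (hreg'' : Scheme.IsRegular X'') (hfaith'' : Function.Injective ρ'')
    (hequiv₀ : ∀ g : G, (ρ'' g).hom ≫ π₀ = π₀ ≫ (ρ g).hom)
    (hcov'' : ∀ y : X'', ∃ O : X''.Opens, IsAffineOpen O ∧ y ∈ O ∧ ∀ g : G, (ρ'' g).hom ⁻¹ᵁ O = O)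
    (Ss : List (Finset (Subgroup G)))
    (hSs : ∀ S ∈ Ss, (∀ (g : G), ∀ K ∈ S, K.map (MulAut.conj g).toMonoidHom ∈ S) ∧ ⊥ ∉ S ∧
      ∀ K ∈ S, (Nat.card K).Coprime p)
    (hdisj : ∀ S ∈ Ss, ∀ K ∈ S, ∀ K' ∈ S, K ≠ K' →
      Disjoint {y : X'' | K ≤ inertiaSubgroup ρ'' y} {y : X'' | K' ≤ inertiaSubgroup ρ'' y})
    (Ms : List (Subgroup G)) (hMs : ∀ M ∈ Ms, M.Normal ∧ M ≠ ⊥ ∧ (Nat.card M).Coprime p)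
    (hA : ∀ H : Subgroup G, ¬ HasNormalSylow p H →
      ∃ K ∈ Ms ++ (Ss.map Finset.toList).flatten, ∃ u ∈ ⁅H, H⁆, (orderOf u).Coprime p ∧
        K ≤ Subgroup.zpowers u) :
    ∃ (Xs : Scheme.{0}) (π : Xs ⟶ X') (ρs : G →* Aut Xs), IsProper π ∧ IsBirational π ∧
      IsIntegral Xs ∧ Scheme.IsRegular Xs ∧ (∀ g : G, (ρs g).hom ≫ π = π ≫ (ρ g).hom) ∧
      (∀ x : Xs, HasNormalSylow p (inertiaSubgroup ρs x)) ∧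
      ∀ x : Xs, ∃ U : Xs.Opens, IsAffineOpen U ∧ x ∈ U ∧ ∀ g : G, (ρs g).hom ⁻¹ᵁ U = U :=
  phaseZero_of_orbitSeparation_kernel p hp k X' X₁ f q G ρ hρ X'' π₀ ρ'' hbir₀ hreg'' hfaith'' hequiv₀ hcov'' Ss hSs
    hdisj Ms hMs (hcoreK_of_commutator p (Ms ++ (Ss.map Finset.toList).flatten) hA)

end Summit.ResolutionOfSingularities.ResolutionOfSingularities.Theorems.WildQuotientResolution.StandardForm

end
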